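import Summits.Ventures.CertifiedManyBodySolver.Theorems.M3x2EdgeSplitSymReplayGramRSoundB
import HarnessLib

/-!
# SymReplay gramR — (g) SHARDED R-certificates (module 4/4)
Text: hub-lb-sym-plan-1 g2 (`Cruxes/LowerEdge_ge_m83o100/SymReplayGramR_symplan1.lean` rev 3, a26d6b87249c), landed verbatim by hub-lb-sym-eng-3. No summit or crux statement is proved here; no certificate beyond toys is replayed; nothing here predicts superconductivity.
-/

noncomputable section

namespace Summit.Ventures.CertifiedManyBodySolver.Theorems.SymReplay

open Matrix Finset
open Literature.MathematicalPhysics.QuantumLattice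
open Literature.MathematicalPhysics.QuantumLattice.HubbardWave0
open Literature.MathematicalPhysics.QuantumLattice.ThermodynamicLimit
open Literature.Probability.LatticeModels
open Literature.MathematicalPhysics.QuantumManyBody.StateRelaxation
open Summit.Ventures.CertifiedManyBodySolver.Theorems.WardSlot
open scoped ComplexOrder BigOperators

/-! ### (g) SHARDED R-certificates — T12b's contract (`…ShardsB`, hub-lb-sym-eng-3) with `rhsPoly ↦ rhsPolyR`

The shards of an R-certificate are T12b's shards of the UNDERLYING certificate `K.toSymCert` (base shard + row chunks of
every ordinary `gramM` block — the generated blocks are never expanded) followed by the row chunks of every R-block's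
REPRESENTATIVE expansion `reps† × genBasis` (chunks of `c + 1` representatives, each carrying `−(|moves|·scale) •`).
They sum to `LHS − RHS_R`; T12b's per-shard pipe `canonNF`, its two-list facts `Facts₂` and their assembly `facts₂_sum`
are reused verbatim; the block lemma of §(d) supplies `RHS(K♯) = RHS_R + Σ block uses`; T12a closes. -/

/-- Row chunk of an R-block's representative expansion: rows `a ∈ ch ⊆ reps.zip rows` against the generated basis. -/
def blockRowsPolyR (B : GramBlockR) (ch : List (QPoly × List (ℚ × ℕ))) : QPoly :=
  ch.flatMap fun a => ((genBasis B).zip B.rows).flatMap fun b =>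
    let g := sdot a.2 b.2
    if g = 0 then [] else pscale g (pmul (padj a.1) b.1)

/-- The shards of one R-block: `−(|moves|·scale) • (rows of a chunk)` per chunk of `c + 1` representatives. -/
def blockShardPolysR (c : ℕ) (B : GramBlockR) : List QPoly :=
  (chunksOf c (B.reps.zip B.rows).length (B.reps.zip B.rows)).map fun ch =>
    pscale (-((B.moves.length : ℚ) * B.scale)) (blockRowsPolyR B ch)

/-- The representative-form block is `scale •` the rows of the full representative list. -/
theorem gramBlockPolyR_eq (B : GramBlockR) :
    gramBlockPolyR B = pscale B.scale (blockRowsPolyR B (B.reps.zip B.rows)) := rfl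

/-- `blockRowsPolyR` is additive in the chunk. -/
theorem polyOp_blockRowsPolyR_flatten (Λ' : Finset (Site 2)) (B : GramBlockR) :
    ∀ (chs : List (List (QPoly × List (ℚ × ℕ)))),
      polyOp Λ' (blockRowsPolyR B chs.flatten) = (chs.map fun ch => polyOp Λ' (blockRowsPolyR B ch)).sum
  | [] => by simp [blockRowsPolyR]
  | ch :: chs => by
    rw [List.flatten_cons, List.map_cons, List.sum_cons, ← polyOp_blockRowsPolyR_flatten Λ' B chs, ← polyOp_append]
    rw [blockRowsPolyR, blockRowsPolyR, blockRowsPolyR, List.flatMap_append]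

/-- The shards of an R-block sum to MINUS its `rhsPolyR` slot `|moves| • D_B`. -/
theorem sum_blockShardPolysR (Λ' : Finset (Site 2)) (c : ℕ) (B : GramBlockR) :
    ((blockShardPolysR c B).map (polyOp Λ')).sum = -polyOp Λ' (pscale (B.moves.length : ℚ) (gramBlockPolyR B)) := by
  have h := polyOp_blockRowsPolyR_flatten Λ' B (chunksOf c (B.reps.zip B.rows).length (B.reps.zip B.rows))
  rw [flatten_chunksOf] at h
  rw [gramBlockPolyR_eq, polyOp_pscale, polyOp_pscale, smul_smul, ← Rat.cast_mul, h, blockShardPolysR]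
  have e : (List.map (fun ch => pscale (-((B.moves.length : ℚ) * B.scale)) (blockRowsPolyR B ch))
      (chunksOf c (B.reps.zip B.rows).length (B.reps.zip B.rows))) =
      ((chunksOf c (B.reps.zip B.rows).length (B.reps.zip B.rows)).map (blockRowsPolyR B)).map
        (fun p => pscale (-((B.moves.length : ℚ) * B.scale)) p) := by
    rw [List.map_map]; rfl
  rw [e, sum_map_pscale_neg, List.map_map]
  rfl

/-- **All shards of an R-certificate**: T12b's shards of the underlying certificate, then every R-block's chunk shards. -/
def shardPolysR (K : SymCertR) (c : ℕ) : List QPoly :=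
  shardPolys K.toSymCert c ++ K.gramR.flatMap (blockShardPolysR c)

/-- The shards of a list of R-blocks sum to minus their `rhsPolyR` slots. -/
theorem sum_flatMap_blockShardPolysR (Λ' : Finset (Site 2)) (c : ℕ) :
    ∀ (Bs : List GramBlockR), ((Bs.flatMap (blockShardPolysR c)).map (polyOp Λ')).sum =
      -polyOp Λ' (Bs.flatMap fun B => pscale (B.moves.length : ℚ) (gramBlockPolyR B))
  | [] => by simp
  | B :: Bs => by
    rw [List.flatMap_cons, List.map_append, List.sum_append, sum_blockShardPolysR, sum_flatMap_blockShardPolysR Λ' c Bs,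
      List.flatMap_cons, polyOp_append, neg_add]

/-- **The R-shards sum to `LHS − RHS_R`.** -/
theorem sum_shardPolysR (Λ' : Finset (Site 2)) (K : SymCertR) (c : ℕ) :
    ((shardPolysR K c).map (polyOp Λ')).sum = polyOp Λ' (lhsPoly K.toSymCert) - polyOp Λ' (rhsPolyR K) := by
  rw [shardPolysR, List.map_append, List.sum_append, sum_shardPolys, sum_flatMap_blockShardPolysR, rhsPolyR,
    polyOp_append]
  abel

/-- The `j`-th R-shard (`[]` past the end). -/
def shardPolyAtR (K : SymCertR) (c j : ℕ) : QPoly := ((shardPolysR K c)[j]?).getD []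

/-- **What ONE farm call proves about R-shard `j`** against its shipped partial `P` (T12b's `shardOK`, R-shards). -/
def shardOKR (K : SymCertR) (c j : ℕ) (P : QPoly) : Bool :=
  psuppIn P K.frame && isZero (psub (canonNF K.frame (shardPolyAtR K c j)) P)

/-- The per-call facts for R-shards `j, j+1, …` against the partials `Ps` (structural on the literal `Ps`). -/
def ShardFactsR (K : SymCertR) (c : ℕ) : ℕ → List QPoly → Prop
  | _, [] => True
  | j, P :: Ps => shardOKR K c j P = true ∧ ShardFactsR K c (j + 1) Ps

/-- Index-based R-shard facts give T12b's two-list facts on the corresponding suffix of `shardPolysR`. -/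
theorem facts₂_of_shardFactsR (K : SymCertR) (c : ℕ) :
    ∀ (Ps : List QPoly) (j : ℕ), ((shardPolysR K c).drop j).length = Ps.length →
      ShardFactsR K c j Ps → Facts₂ K.toSymCert ((shardPolysR K c).drop j) Ps
  | [], j, hl, _ => by
    rw [List.length_nil, List.length_eq_zero_iff] at hl
    rw [hl]; trivial
  | P :: Ps, j, hl, hf => by
    have hj : j < (shardPolysR K c).length := by
      rw [List.length_drop, List.length_cons] at hl; omega
    rw [List.drop_eq_getElem_cons hj]
    have hQ : shardPolyAtR K c j = (shardPolysR K c)[j] := by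
      rw [shardPolyAtR, List.getElem?_eq_getElem hj]; rfl
    refine ⟨?_, facts₂_of_shardFactsR K c Ps (j + 1) ?_ hf.2⟩
    · rw [← hQ]; exact hf.1
    · have := hl; rw [List.drop_eq_getElem_cons hj, List.length_cons, List.length_cons] at this; omega

/-- Words of a row chunk of an R-block lie where the representatives and the generated basis do. -/
theorem PSupp_blockRowsPolyR (B : GramBlockR) {Λ : Finset (Site 2)} (hs : ∀ s ∈ B.reps, PSupp s Λ)
    (hq : ∀ q ∈ genBasis B, PSupp q Λ) (ch : List (QPoly × List (ℚ × ℕ))) (hch : ∀ a ∈ ch, a ∈ B.reps.zip B.rows) :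
    PSupp (blockRowsPolyR B ch) Λ := by
  refine PSupp.flatMap _ _ fun a ha => PSupp.flatMap _ _ fun b hb => ?_
  have ha' : PSupp a.1 Λ := hs _ (List.of_mem_zip (hch a ha)).1
  have hb' : PSupp b.1 Λ := hq _ (List.of_mem_zip hb).1
  dsimp only
  split_ifs
  · exact PSupp_nil _
  · exact (ha'.padj.pmul hb').pscale _

/-- Words of every R-block shard lie where the representatives and the generated basis do. -/
theorem PSupp_blockShardPolysR (c : ℕ) (B : GramBlockR) {Λ : Finset (Site 2)} (hs : ∀ s ∈ B.reps, PSupp s Λ)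
    (hq : ∀ q ∈ genBasis B, PSupp q Λ) : ∀ Q ∈ blockShardPolysR c B, PSupp Q Λ := by
  intro Q hQ
  rw [blockShardPolysR, List.mem_map] at hQ
  obtain ⟨ch, hch, rfl⟩ := hQ
  refine (PSupp_blockRowsPolyR B hs hq ch fun a ha => ?_).pscale _
  rw [← flatten_chunksOf c (B.reps.zip B.rows).length (B.reps.zip B.rows), List.mem_flatten]
  exact ⟨ch, hch, ha⟩

/-- **SHARDED R-REPLAY IS SOUND.**  For an R-certificate whose expansion `K♯` is well formed and whose R-blocks pass
`gramBlockROK` (generation + eigen-checks — no products), a chunk size `c`, shipped partials `Ps` (one per shard of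
`shardPolysR K c`), the per-call facts `ShardFactsR K c 0 Ps`, and the final fact
`isZero (canonNF K.frame (P_0 ++ … ++ P_m)) = true`: `K` is a Ward × affine-`D₄` window certificate of value `symValueR K`. -/
theorem wardD4CertGe_of_shardsR (K : SymCertR) (hwf0 : wellFormed K.expand = true)
    (hRok : K.gramR.all (gramBlockROK K.frame) = true) (c : ℕ) (Ps : List QPoly)
    (hlen : (shardPolysR K c).length = Ps.length) (hfacts : ShardFactsR K c 0 Ps)
    (hfin : isZero (canonNF K.frame Ps.flatten) = true) : WardD4CertGe ((symValueR K : ℚ) : ℝ) := by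
  have hRok' : ∀ B ∈ K.gramR, gramBlockROK K.frame B = true := List.all_eq_true.1 hRok
  /- (1) the well-formedness clauses of `K♯` needed for the supports -/
  have hwf := hwf0
  simp only [wellFormed, Bool.and_eq_true] at hwf
  obtain ⟨⟨⟨⟨⟨⟨⟨⟨⟨⟨⟨⟨⟨-, hz0⟩, hn0⟩, hIF⟩, -⟩, hgram⟩, hgM⟩, heom⟩, hmov⟩, hch⟩, hwp⟩, hwm⟩, hah⟩, hsl⟩ := hwf
  have hgram' : ∀ g ∈ K.toSymCert.gram, psuppIn g.2 K.toSymCert.frame = true := fun g hg => by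
    have h := List.all_eq_true.1 hgram g hg
    rw [Bool.and_eq_true] at h
    exact h.2
  have hgM' : ∀ B ∈ K.toSymCert.gramM, ∀ q ∈ B.basis, PSupp q K.frame.toFinset := fun B hB q hq => by
    have hB' : B ∈ K.expand.gramM := by
      change B ∈ K.gramM ++ K.gramR.map toGramBlock
      exact List.mem_append_left _ hB
    have h := List.all_eq_true.1 hgM B hB'
    simp only [gramBlockOK, Bool.and_eq_true, List.all_eq_true] at h
    exact PSupp_of_psuppIn (h.2 q hq)
  have heom' : ∀ B ∈ K.toSymCert.eom, psuppIn B K.toSymCert.inner = true := fun B hB => List.all_eq_true.1 heom B hB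
  have hmov' : ∀ mv ∈ K.toSymCert.moves, suppIn mv.u K.toSymCert.frame = true ∧
      suppIn (moveWordF mv.γ mv.v mv.u) K.toSymCert.frame = true := fun mv hmv => by
    have h := List.all_eq_true.1 hmov mv hmv
    rwa [Bool.and_eq_true] at h
  have hch' : ∀ t ∈ K.toSymCert.charged, suppIn t.2 K.toSymCert.frame = true := fun t ht => by
    have h := List.all_eq_true.1 hch t ht
    rw [Bool.and_eq_true] at h
    exact h.1
  have hwp' : ∀ X ∈ K.toSymCert.wardP, psuppIn X K.toSymCert.frame = true := fun X hX => List.all_eq_true.1 hwp X hX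
  have hwm' : ∀ X ∈ K.toSymCert.wardM, psuppIn X K.toSymCert.frame = true := fun X hX => List.all_eq_true.1 hwm X hX
  have hah' : ∀ t ∈ K.toSymCert.antiH, psuppIn t.2 K.toSymCert.frame = true := fun t ht => List.all_eq_true.1 hah t ht
  have hsl' : ∀ t ∈ K.toSymCert.slack, suppIn t.2 K.toSymCert.frame = true := fun t ht => List.all_eq_true.1 hsl t ht
  have h0F : thicken ({0} : Finset (Site 2)) 1 ⊆ K.expand.frame.toFinset := by
    have h : subSites (thick [0]) K.expand.frame = true := by simpa [thick] using hn0
    have h' := thicken_subset_of_thick h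
    simpa using h'
  have hsD : ∀ B ∈ K.gramR, (∀ s ∈ B.reps, PSupp s K.frame.toFinset) ∧ ∀ q ∈ genBasis B, PSupp q K.frame.toFinset :=
    fun B hB => ⟨fun s hs => ((gramBlockROK_spec (hRok' B hB)).1 s hs).1, fun q hq => by
      rw [genBasis, List.mem_map] at hq
      obtain ⟨s, hs, rfl⟩ := hq
      exact PSupp_genOne ((gramBlockROK_spec (hRok' B hB)).1 s hs).2⟩
  /- (2) supports of all R-shards -/
  have hQ : ∀ Q ∈ shardPolysR K c, PSupp Q K.frame.toFinset := by
    intro Q hQ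
    rw [shardPolysR, List.mem_append, shardPolys, List.mem_cons] at hQ
    rcases hQ with (rfl | hQ) | hQ
    · exact (PSupp_lhsPoly K.toSymCert h0F).psub
        (PSupp_rhsNonBlock K.toSymCert hgram' heom' hIF hmov' hch' hwp' hwm' hah' hsl')
    · rw [List.mem_flatMap] at hQ
      obtain ⟨B, hB, hQ⟩ := hQ
      exact PSupp_blockShardPolys c B (hgM' B hB) Q hQ
    · rw [List.mem_flatMap] at hQ
      obtain ⟨B, hB, hQ⟩ := hQ
      exact PSupp_blockShardPolysR c B (hsD B hB).1 (hsD B hB).2 Q hQ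
  /- (3) the two-list facts -/
  have hF : Facts₂ K.toSymCert (shardPolysR K c) Ps := by
    have h := facts₂_of_shardFactsR K c Ps 0 (by rw [List.drop_zero]; exact hlen) hfacts
    rwa [List.drop_zero] at h
  /- (4) the DERIVED use family and its envelope -/
  let U := ((shardPolysR K c).flatMap (canonNFUses K.frame) ++ canonNFUses K.frame Ps.flatten) ++
    (K.gramR.flatMap blockUses).map negUse
  have hL : (envelope K.expand U).toList.toFinset = envelope K.expand U := Finset.toList_toFinset _
  have hFL : K.frame.toFinset ⊆ (envelope K.expand U).toList.toFinset := by
    rw [hL]; exact (subset_thicken _ 1).trans (thicken_subset_envelope K.expand U)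
  obtain ⟨hsum, hPs⟩ := facts₂_sum K.toSymCert hFL (shardPolysR K c) Ps hF hQ
  have hU : ∀ e ∈ U, SuppIn e.u K.expand.frame.toFinset := by
    intro e he
    rcases List.mem_append.1 he with he | he
    · rcases List.mem_append.1 he with he | he
      · rw [List.mem_flatMap] at he
        obtain ⟨Q, hQ', he⟩ := he
        exact canonNFUses_supp K.frame Q (hQ Q hQ') e he
      · exact canonNFUses_supp K.frame _ hPs e he
    · rw [List.mem_map] at he
      obtain ⟨e', he', rfl⟩ := he
      rw [List.mem_flatMap] at he'
      obtain ⟨B, hB, he'⟩ := he'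
      rw [blockUses, List.mem_flatMap] at he'
      obtain ⟨m, -, he'⟩ := he'
      obtain ⟨t, ht, hu⟩ := polyUses_u he'
      show SuppIn e'.u K.frame.toFinset
      rw [hu]
      exact PSupp_gramBlockPolyR B (hsD B hB).1 (hsD B hB).2 t ht
  refine wardD4CertGe_of_expansion K.expand hwf0 U hU ?_
  /- (5) the expansion: LHS − RHS(K♯) = (LHS − RHS_R) − Σ block uses = Σ partials + shard uses − block uses,
        and Σ partials = final uses -/
  have hBL : ∀ B ∈ K.gramR, (∀ s ∈ B.reps, PSupp (genPre B.moves s) (envelope K.expand U).toList.toFinset) ∧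
      ∀ q ∈ genBasis B, ∀ m ∈ B.moves,
        PSupp (movePolyF m.γ m.v q) (envelope K.expand U).toList.toFinset ∧
          isZero (psub (nfPoly (movePolyF m.γ m.v q)) (pscale m.χ q)) = true := fun B hB =>
    ⟨fun s hs => (((gramBlockROK_spec (hRok' B hB)).1 s hs).2).mono hFL,
      fun q hq m hm => ⟨((gramBlockROK_spec (hRok' B hB)).2 q hq m hm).1.mono hFL,
        ((gramBlockROK_spec (hRok' B hB)).2 q hq m hm).2⟩⟩
  have h2 := polyOp_rhsPoly_expand (envelope K.expand U).toList.toFinset K hBL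
  have hfinal := canonNF_expansion K.frame hFL Ps.flatten (hPs.mono hFL)
  rw [polyOp_eq_zero_of_isZero _ _ hfin, zero_add] at hfinal
  rw [sum_shardPolysR] at hsum
  have hl : lhsPoly K.expand = lhsPoly K.toSymCert := rfl
  have hneg : (((K.gramR.flatMap blockUses).map negUse).map (useOp (envelope K.expand U).toList.toFinset)).sum =
      -((K.gramR.flatMap blockUses).map (useOp (envelope K.expand U).toList.toFinset)).sum := by
    rw [List.map_map, ← list_sum_map_neg]
    simp only [Function.comp_def, useOp_negUse]
  rw [hl, h2, List.map_append, List.sum_append, List.map_append, List.sum_append, ← hfinal, hneg,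
    sub_eq_iff_eq_add.1 hsum]
  abel

/-- **Corollary**: a sharded R-certificate bounds the energy density (S6 = `WardSlot.stub_wardWindowSound`). -/
theorem energyDensity_ge_of_shardsR (K : SymCertR) (hwf : wellFormed K.expand = true)
    (hRok : K.gramR.all (gramBlockROK K.frame) = true) (c : ℕ) (Ps : List QPoly)
    (hlen : (shardPolysR K c).length = Ps.length) (hfacts : ShardFactsR K c 0 Ps)
    (hfin : isZero (canonNF K.frame Ps.flatten) = true) :
    ((symValueR K : ℚ) : ℝ) ≤ energyDensityTT' 1 0 8 (7 / 8) :=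
  energyDensity_ge_of_windowSound_cert _ WardSlot.stub_wardWindowSound
    (wardD4CertGe_of_shardsR K hwf hRok c Ps hlen hfacts hfin)

/-! ##### The EXECUTED per-shard pipe (canonicaliser `canonTermAV` of `…SyntaxV`, integer-pair corner) -/

/-- T12b's per-shard pipe with the executed canonicaliser `canonTermAV` (same value, `canonNFAV_eq`). -/
def canonNFAV (frame : List (Site 2)) (p : QPoly) : QPoly :=
  (collect (nfPoly p)).flatMap (canonTermAV (minCornerP frame) frame)

/-- Helper `canonNFAV_eq` (gramR shards). -/
theorem canonNFAV_eq (frame : List (Site 2)) (p : QPoly) : canonNFAV frame p = canonNF frame p := by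
  unfold canonNFAV canonNF
  simp only [canonTermAV_eq, mkSite_minCornerP_eq]

/-- Executed form of `shardOKR`. -/
def shardOKRV (K : SymCertR) (c j : ℕ) (P : QPoly) : Bool :=
  psuppIn P K.frame && isZero (psub (canonNFAV K.frame (shardPolyAtR K c j)) P)

/-- Helper `shardOKRV_eq` (gramR shards). -/
theorem shardOKRV_eq (K : SymCertR) (c j : ℕ) (P : QPoly) : shardOKRV K c j P = shardOKR K c j P := by
  unfold shardOKRV shardOKR
  rw [canonNFAV_eq]

/-- Executed form of `ShardFactsR` (each conjunct is ONE `native_decide` on `shardOKRV`). -/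
def ShardFactsRV (K : SymCertR) (c : ℕ) : ℕ → List QPoly → Prop
  | _, [] => True
  | j, P :: Ps => shardOKRV K c j P = true ∧ ShardFactsRV K c (j + 1) Ps

/-- Helper `shardFactsR_of_RV` (gramR shards). -/
theorem shardFactsR_of_RV (K : SymCertR) (c : ℕ) : ∀ (j : ℕ) (Ps : List QPoly), ShardFactsRV K c j Ps → ShardFactsR K c j Ps
  | _, [], _ => trivial
  | j, P :: Ps, h => ⟨(shardOKRV_eq K c j P) ▸ h.1, shardFactsR_of_RV K c (j + 1) Ps h.2⟩

/-- **Sharded R-replay, executed form**: the closing grammar of a real R-literal — `hwf`/`hRok`/`hlen` by one cheap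
`native_decide` each, `hfacts := ⟨by native_decide, …, trivial⟩` (one per shard, `shardOKRV`), `hfin` by one. -/
theorem energyDensity_ge_of_shardsRV (K : SymCertR) (hwf : wellFormed K.expand = true)
    (hRok : K.gramR.all (gramBlockROK K.frame) = true) (c : ℕ) (Ps : List QPoly)
    (hlen : (shardPolysR K c).length = Ps.length) (hfacts : ShardFactsRV K c 0 Ps)
    (hfin : isZero (canonNFAV K.frame Ps.flatten) = true) :
    ((symValueR K : ℚ) : ℝ) ≤ energyDensityTT' 1 0 8 (7 / 8) :=
  energyDensity_ge_of_shardsR K hwf hRok c Ps hlen (shardFactsR_of_RV K c 0 Ps hfacts) (by rwa [canonNFAV_eq] at hfin)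

/-! ##### Kernel demo: `toyRCert` in three R-shards (base shard + one chunk per R-block) -/

/-- The partials of the demo: each shard's own canonical normal form (a lander ships literals). -/
def toyRPartials : List QPoly :=
  [canonNF toyRCert.frame (shardPolyAtR toyRCert 0 0), canonNF toyRCert.frame (shardPolyAtR toyRCert 0 1),
    canonNF toyRCert.frame (shardPolyAtR toyRCert 0 2)]

/-- Helper `toyR_len` (gramR shards). -/
theorem toyR_len : (shardPolysR toyRCert 0).length = toyRPartials.length := by decide +kernel

/-- Helper `toyR_facts` (gramR shards). -/
theorem toyR_facts : ShardFactsR toyRCert 0 0 toyRPartials := by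
  unfold toyRPartials
  refine ⟨by decide +kernel, ?_⟩
  refine ⟨by decide +kernel, ?_⟩
  refine ⟨by decide +kernel, ?_⟩
  exact trivial

/-- Helper `toyR_final` (gramR shards). -/
theorem toyR_final : isZero (canonNF toyRCert.frame toyRPartials.flatten) = true := by decide +kernel

/-- Helper `toyR_wf` (gramR shards). -/
theorem toyR_wf : wellFormed toyRCert.expand = true := by decide +kernel

/-- Helper `toyR_rok` (gramR shards). -/
theorem toyR_rok : toyRCert.gramR.all (gramBlockROK toyRCert.frame) = true := by decide +kernel

/-- The per-shard facts are not vacuous: no single shard of `toyRCert` closes on its own (only their sum does), and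
the executed pipe agrees with T12b's on a shard. -/
example : shardOKR toyRCert 0 0 [] = false ∧ shardOKR toyRCert 0 1 [] = false ∧ shardOKR toyRCert 0 2 [] = false := by
  decide +kernel

example : shardOKRV toyRCert 0 1 (canonNF toyRCert.frame (shardPolyAtR toyRCert 0 1)) = true := by decide +kernel

/-- **`toyRCert` replayed in SHARDS, end to end, no hypothesis**: `−11/4 ≤ e₀(1, 0, 8, 7/8)` again, this time through
`energyDensity_ge_of_shardsR` (standard axioms; `decide +kernel` only). -/
example : (((-11) / 4 : ℚ) : ℝ) ≤ energyDensityTT' 1 0 8 (7 / 8) := by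
  have h := energyDensity_ge_of_shardsR toyRCert toyR_wf toyR_rok 0 toyRPartials toyR_len toyR_facts toyR_final
  rwa [show symValueR toyRCert = (-11) / 4 from toyRCert_value] at h

end Summit.Ventures.CertifiedManyBodySolver.Theorems.SymReplay

end
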